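import Summits.Ventures.HodgeRepro2.A2PontryaginTable
import Summits.Ventures.HodgeRepro2.A2HodgeSymmetry

/-!
# A2CoefficientConjugation — conjugating the coefficients on the monomial basis: an antilinear
ring involution of the model fixing every bidegree and commuting with the Pontryagin product

Tier-4 annex of sub-claim A2 (seat p6, cell pub-hodge-repro2); §8(d): uses an L-value-free
non-vanishing device: NO.

The model `A ι = ⋀ V ι` has the basis of monomials `e_s = aBasis s` (row 90) with structure
constants `±1` for the cup product (`e_s ∧ e_t = ± e_{s ∪ t}` or `0`) and `±vol = ±1` for the
Pontryagin product (row 128).  Hence the ℂ-antilinear map `coeffConj` that conjugates the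
coordinates in this basis (`Σ c_s e_s ↦ Σ c̄_s e_s`) is

* an involution (`coeffConj_coeffConj`), fixing every basis monomial (`coeffConj_aBasis`) and
  every bidegree `hgrading a b` (`coeffConj_mem_hgrading`);
* multiplicative for the cup product (`coeffConj_mul`) and for the Pontryagin product
  (`coeffConj_pontryagin`);
* compatible with the integral: `∫_B (coeffConj x) = conj (∫_B x)` (`integral_coeffConj`).

Together with row 127's linear swap `a_p ↔ b_p` it gives the complex conjugation of the model
(sequel file `A2ModelConjugation.lean`).  What stays prose: that in the eigenform basis
`ℓ_τ, ℓ_τ̄` of `H^1(B, ℂ)` complex conjugation is exactly «swap ∘ conjugate the coefficients»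
(A4.2 / A0.3 (iii)); not on the N1 chain.
-/

namespace Summit.Ventures.HodgeRepro2.A2CoefficientConjugation

open WeilPlanes WeilIntegral WeilCoproduct A2ModelDuality A2PontryaginModel A2HodgeTypeModel
  A2HodgeBigrading A2PontryaginTable A2PontryaginOperator

variable {ι : Type*} [DecidableEq ι] [Fintype ι]

/-- Conjugation of the coordinates in the monomial basis of row 90, as a `conj`-semilinear map. -/
noncomputable def coeffConj : A ι →ₛₗ[starRingEnd ℂ] A ι where
  toFun x := aBasis.repr.symm (Finsupp.mapRange (starRingEnd ℂ) (map_zero _) (aBasis.repr x))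
  map_add' x y := by
    rw [map_add, Finsupp.mapRange_add (map_add _), map_add]
  map_smul' c x := by
    have h : Finsupp.mapRange (starRingEnd ℂ) (map_zero _) (c • aBasis.repr x) =
        (starRingEnd ℂ) c • Finsupp.mapRange (starRingEnd ℂ) (map_zero _) (aBasis.repr x) := by
      ext s
      simp [Finsupp.mapRange_apply, Finsupp.smul_apply, map_mul]
    simp only [map_smul, h]

omit [DecidableEq ι] in
/-- `coeffConj x = repr⁻¹ (conj ∘ repr x)`. -/
theorem coeffConj_apply (x : A ι) :
    coeffConj x = aBasis.repr.symm (Finsupp.mapRange (starRingEnd ℂ) (map_zero _) (aBasis.repr x)) :=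
  rfl

omit [DecidableEq ι] in
/-- The coordinates of `coeffConj x` are the conjugates of those of `x`. -/
theorem repr_coeffConj (x : A ι) (s : Finset (Fin (Fintype.card (Gen ι)))) :
    aBasis.repr (coeffConj x) s = (starRingEnd ℂ) (aBasis.repr x s) := by
  rw [coeffConj_apply, LinearEquiv.apply_symm_apply, Finsupp.mapRange_apply]

omit [DecidableEq ι] in
/-- The basis monomials are fixed. -/
theorem coeffConj_aBasis (s : Finset (Fin (Fintype.card (Gen ι)))) : coeffConj (aBasis s) = aBasis s := by
  rw [coeffConj_apply, Module.Basis.repr_self, Finsupp.mapRange_single, map_one,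
    Module.Basis.repr_symm_single, one_smul]

omit [DecidableEq ι] in
/-- `coeffConj` is an involution. -/
theorem coeffConj_coeffConj (x : A ι) : coeffConj (coeffConj x) = x := by
  rw [coeffConj_apply, coeffConj_apply, LinearEquiv.apply_symm_apply, Finsupp.mapRange_mapRange]
  have h : ((starRingEnd ℂ) ∘ (starRingEnd ℂ)) = id := funext fun c => starRingEnd_self_apply c
  simp only [h, Finsupp.mapRange_id, LinearEquiv.symm_apply_apply]

omit [DecidableEq ι] in
/-- `coeffConj` is injective. -/
theorem coeffConj_injective : Function.Injective (coeffConj : A ι → A ι) :=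
  Function.LeftInverse.injective coeffConj_coeffConj

omit [DecidableEq ι] in
/-- A real multiple of a basis monomial is fixed: `coeffConj (ε • e_s) = ε • e_s` for `ε = ±1`. -/
theorem coeffConj_sign_smul_aBasis {ε : ℂ} (hε : ε = 1 ∨ ε = -1)
    (s : Finset (Fin (Fintype.card (Gen ι)))) : coeffConj (ε • aBasis s) = ε • aBasis s := by
  rw [LinearMap.map_smulₛₗ, coeffConj_aBasis]
  rcases hε with rfl | rfl <;> simp

/-- `coeffConj` commutes with the cup product: the structure constants of the monomial basis
are `±1` (`e_s ∧ e_t = mono (genListOf s ++ genListOf t) = ± e_{s ∪ t}` or `0`). -/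
theorem coeffConj_mul (x y : A ι) : coeffConj (x * y) = coeffConj x * coeffConj y := by
  -- both sides are semilinear in `x` (for fixed `y`) and in `y`: compare on the basis twice
  have key : ∀ s t : Finset (Fin (Fintype.card (Gen ι))),
      coeffConj (aBasis s * aBasis t) = aBasis s * aBasis t := by
    intro s t
    rw [aBasis_apply, aBasis_apply, ← mono_append]
    by_cases hn : (genListOf s ++ genListOf t).Nodup
    · obtain ⟨ε, hε, h⟩ := exists_sign_mono_eq_aBasis hn
      rw [h, coeffConj_sign_smul_aBasis hε]
    · rw [mono_eq_zero_of_not_nodup hn, map_zero]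
  have h1 : ∀ t : Finset (Fin (Fintype.card (Gen ι))),
      (coeffConj.comp (LinearMap.mulRight ℂ (aBasis t)) : A ι →ₛₗ[starRingEnd ℂ] A ι) =
        (LinearMap.mulRight ℂ (aBasis t)).comp coeffConj := by
    intro t
    refine aBasis.ext fun s => ?_
    simp only [LinearMap.comp_apply, LinearMap.mulRight_apply]
    rw [key, coeffConj_aBasis]
  have h2 : (coeffConj.comp (LinearMap.mulLeft ℂ x) : A ι →ₛₗ[starRingEnd ℂ] A ι) =
      (LinearMap.mulLeft ℂ (coeffConj x)).comp coeffConj := by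
    refine aBasis.ext fun t => ?_
    simp only [LinearMap.comp_apply, LinearMap.mulLeft_apply]
    have := LinearMap.congr_fun (h1 t) x
    simp only [LinearMap.comp_apply, LinearMap.mulRight_apply] at this
    rw [this, coeffConj_aBasis]
  have := LinearMap.congr_fun h2 y
  simpa only [LinearMap.comp_apply, LinearMap.mulLeft_apply] using this

/-- `coeffConj 1 = 1`. -/
theorem coeffConj_one : coeffConj (1 : A ι) = 1 := by
  have h : (1 : A ι) = mono [] := by simp [mono]
  have h' := exists_sign_mono_eq_aBasis (l := ([] : List (Gen ι))) List.nodup_nil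
  obtain ⟨ε, hε, hε'⟩ := h'
  rw [h, hε', coeffConj_sign_smul_aBasis hε]

/-- `coeffConj` preserves every bidegree `hgrading a b`. -/
theorem coeffConj_mem_hgrading {a b : ℕ} {x : A ι} (hx : x ∈ hgrading a b) :
    coeffConj x ∈ hgrading a b := by
  rw [hgrading_eq_span] at hx ⊢
  refine Submodule.span_induction (p := fun x _ => coeffConj x ∈
    Submodule.span ℂ (aBasis '' {s | bideg s = (a, b)})) ?_ ?_ ?_ ?_ hx
  · rintro _ ⟨s, hs, rfl⟩
    rw [coeffConj_aBasis]
    exact Submodule.subset_span ⟨s, hs, rfl⟩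
  · rw [map_zero]
    exact Submodule.zero_mem _
  · intro x y _ _ hx hy
    rw [map_add]
    exact Submodule.add_mem _ hx hy
  · intro c x _ hx
    rw [LinearMap.map_smulₛₗ]
    exact Submodule.smul_mem _ _ hx

/-- `coeffConj` preserves every degree `⋀^k`. -/
theorem coeffConj_mem_grading {k : ℕ} {x : A ι} (hx : x ∈ grading ι k) :
    coeffConj x ∈ grading ι k := by
  rw [grading_eq_span_aBasis] at hx ⊢
  refine Submodule.span_induction (p := fun x _ => coeffConj x ∈
    Submodule.span ℂ (aBasis '' {s | s.card = k})) ?_ ?_ ?_ ?_ hx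
  · rintro _ ⟨s, hs, rfl⟩
    rw [coeffConj_aBasis]
    exact Submodule.subset_span ⟨s, hs, rfl⟩
  · rw [map_zero]
    exact Submodule.zero_mem _
  · intro x y _ _ hx hy
    rw [map_add]
    exact Submodule.add_mem _ hx hy
  · intro c x _ hx
    rw [LinearMap.map_smulₛₗ]
    exact Submodule.smul_mem _ _ hx

/-- The integral of a basis monomial is real (`0` or `±1`). -/
theorem integral_aBasis_real (s : Finset (Fin (Fintype.card (Gen ι)))) :
    (starRingEnd ℂ) (integral (aBasis s)) = integral (aBasis s) := by
  rw [aBasis_apply]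
  by_cases hs : ∀ j, j ∈ genListOf s
  · obtain ⟨ε, hε, h⟩ := integral_mono_of_forall_mem (A2LamAdjoint.genListOf_nodup s) hs
    rw [h]
    rcases hε with rfl | rfl <;> simp
  · rw [integral_mono_eq_zero (Or.inr (not_forall.mp hs)), map_zero]

/-- `∫_B (coeffConj x) = conj (∫_B x)`. -/
theorem integral_coeffConj (x : A ι) : integral (coeffConj x) = (starRingEnd ℂ) (integral x) := by
  conv_lhs => rw [← aBasis.sum_repr x]
  conv_rhs => rw [← aBasis.sum_repr x]
  rw [map_sum, map_sum, map_sum, map_sum]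
  refine Finset.sum_congr rfl fun s _ => ?_
  rw [LinearMap.map_smulₛₗ, coeffConj_aBasis, map_smul, map_smul, smul_eq_mul, smul_eq_mul,
    map_mul, integral_aBasis_real]

/-- `coeffConj` commutes with the Pontryagin product: its structure constants on the monomial
basis are `±vol = ±1` (row 128). -/
theorem coeffConj_pontryagin (z x : A ι) :
    coeffConj (pontryagin z x) = pontryagin (coeffConj z) (coeffConj x) := by
  have key : ∀ s t : Finset (Fin (Fintype.card (Gen ι))),
      coeffConj (pontryagin (aBasis s) (aBasis t)) = pontryagin (aBasis s) (aBasis t) := by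
    intro s t
    obtain ⟨ε, hε, h⟩ := pontryagin_aBasis_aBasis (ι := ι) s t
    rw [h]
    split_ifs with hst
    · obtain ⟨v, hv, hvol⟩ := vol_eq ι
      rw [hvol]
      refine coeffConj_sign_smul_aBasis ?_ _
      rcases hε with rfl | rfl <;> rcases hv with rfl | rfl <;> simp
    · rw [map_zero]
  -- the linear map `x ↦ z ⋆ x` (row 117's right linearity)
  let pontryaginR : A ι → A ι →ₗ[ℂ] A ι := fun z =>
    { toFun := fun x => pontryagin z x
      map_add' := fun x y => A2PontryaginFullPlane.pontryagin_add_right z x y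
      map_smul' := fun r x => A2PontryaginFullPlane.pontryagin_smul_right r z x }
  have h1 : ∀ t : Finset (Fin (Fintype.card (Gen ι))),
      (coeffConj.comp (pontryaginL (aBasis t)) : A ι →ₛₗ[starRingEnd ℂ] A ι) =
        (pontryaginL (aBasis t)).comp coeffConj := by
    intro t
    refine aBasis.ext fun s => ?_
    simp only [LinearMap.comp_apply, pontryaginL_apply]
    rw [key, coeffConj_aBasis]
  have h2 : (coeffConj.comp (pontryaginR z) : A ι →ₛₗ[starRingEnd ℂ] A ι) =
      (pontryaginR (coeffConj z)).comp coeffConj := by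
    refine aBasis.ext fun t => ?_
    simp only [LinearMap.comp_apply, pontryaginR, LinearMap.coe_mk, AddHom.coe_mk]
    have := LinearMap.congr_fun (h1 t) z
    simp only [LinearMap.comp_apply, pontryaginL_apply] at this
    rw [this, coeffConj_aBasis]
  have := LinearMap.congr_fun h2 x
  simpa only [LinearMap.comp_apply, pontryaginR, LinearMap.coe_mk, AddHom.coe_mk] using this

end Summit.Ventures.HodgeRepro2.A2CoefficientConjugation
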